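import Literature.Computability.Cryptography.PeriodFindingEmbed
import Literature.Computability.Cryptography.PeriodFindingUnits
import Literature.Computability.Complexity.UnaryArithMachines
import HarnessLib

/-!
# Period finding by eigenvalue estimation of shifts, IX: the family of the distinguisher and its law

Family `PQC` / quantum-advantage barrier `PPolyOracles`; ninth file towards the discharge of
`Literature.Barriers.QuantumAdvantage.aaronsonChen2017_lem75_quantum` (Aaronson–Chen 2017,
Lemma 7.5 (2)–(3), App. 13). The quantum core of the distinguisher, as a Clifford+T family with
oracle gates: on inputs of length `n`, for every candidate block length `L = n + λ`,
`λ ≤ Lmax n`, and every trial (two halves of six), one unit of the shift experiment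
(`sandwich (blockCirc (spec P n) n)`: `Lv` levels of `B` cosine and `B` sine tests each, offsets
of `Ltop` bits, queries with the unary headers `1ⁿ 0 1ʲ 0` of `UnaryArithMachines.lean`), and its
**read-out law relative to any oracle** (`family_law`): the units are independent and follow the
per-unit laws of the answer tables `Fu` (`sandwich_law_struct` with the placement identities of
`PeriodFindingEmbed.lean`: the offset register as `∏_u [0, 2^{L_u})` times junk, `zvEquiv`, and
Kitaev's exponent, `trialExp_eq_sum`, `blockR_iff_shift`).

## References

* S. Aaronson, L. Chen, CCC 2017 (arXiv:1612.05903), Lemma 7.5 (2)–(3), App. 13 [AaronsonChen2017].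
* A. Yu. Kitaev, arXiv:quant-ph/9511026 (1995), §3–§4 [Kitaev1995].
* D. Boneh, R. J. Lipton, CRYPTO '95, LNCS 963 (1995) 424–437 [BonehLipton1995].
-/

noncomputable section

namespace Literature.Computability.Cryptography

namespace PeriodFinding

open QuantumComplexity QuantumComplexity.RazTalMachine QuantumComplexity.RevSim QuantumComplexity.OSim
  Finset Function Matrix Kitaev1995 Complexity

/-! ### Parameters -/

/-- **Parameters of the family**: the bound `Lmax n` on the candidate block lengths probed on
inputs of length `n` (in the application the polynomial bound of `IsEfficientFamily`). [folklore] -/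
structure FParams where
  /-- candidate lengths are `n, …, n + Lmax n` -/
  Lmax : ℕ → ℕ

variable (P : FParams) (n : ℕ)

/-- Number of candidate lengths. [folklore] -/
def nL : ℕ := P.Lmax n + 1
/-- Number of levels (one more than every candidate length). [cite: Kitaev1995, §3 Thm 1] -/
def Lv : ℕ := n + nL P n + 1
/-- Repetitions per test (accuracy defect `≤ 1/(1152 · nL)`). [cite: Kitaev1995, §3 (before Lemma 9)] -/
def Bn : ℕ := 147456 * Lv P n * nL P n
/-- Register width. [folklore] -/
def Ltop : ℕ := n + nL P n
/-- Number of units: lengths × halves × trials. [folklore] -/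
def nU : ℕ := nL P n * (2 * 6)
/-- Steps per unit: levels × types × repetitions. [folklore] -/
def Kn : ℕ := Lv P n * (2 * Bn P n)

/-- The unit of index `u`: (length index, half, trial). [folklore] -/
def eU : Fin (nU P n) ≃ Fin (nL P n) × (Fin 2 × Fin 6) :=
  finProdFinEquiv.symm.trans (Equiv.prodCongr (Equiv.refl _) finProdFinEquiv.symm)

/-- The test of step `s`: (level, type, repetition). [folklore] -/
def eK : Fin (Kn P n) ≃ TIdx (Lv P n) (Bn P n) :=
  finProdFinEquiv.symm.trans (Equiv.prodCongr (Equiv.refl _)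
    (finProdFinEquiv.symm.trans (Equiv.prodCongr finTwoEquiv (Equiv.refl _))))

/-- The block length of unit `u`: `n + λ`. [folklore] -/
def Lof (u : Fin (nU P n)) : ℕ := n + ((eU P n u).1 : ℕ)

/-- The constant prefix of query `j`: `1ⁿ 0 1ʲ 0` (so that `cpre j ++ x' = hdr n j x'`). [cite: AroraBarakCC2009, §1.3] -/
def cpre (j : ℕ) : List Bool := if j < Ltop P n then ones n ++ false :: (ones j ++ [false]) else []

/-- Positivity of the parameters. [folklore] -/
theorem Lv_pos : 0 < Lv P n := by unfold Lv; omega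

/-- Positivity of the parameters. [folklore] -/
theorem nL_pos : 0 < nL P n := by unfold nL; omega

/-- Positivity of the parameters. [folklore] -/
theorem Bn_pos : 0 < Bn P n := by
  unfold Bn
  have := Lv_pos P n
  have := nL_pos P n
  positivity

/-- **The block specification on inputs of length `n`.** [folklore] -/
abbrev spec : BSpec where
  nU := nU P n
  L := Lof P n
  K := Kn P n
  hK := by
    unfold Kn
    have := Lv_pos P n
    have := Bn_pos P n
    positivity
  lvl s := ((eK P n s).1 : ℕ)
  Ltop := Ltop P n
  hL u := by
    unfold Lof Ltop
    have := (eU P n u).1.isLt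
    omega
  plen := n + Ltop P n + 2
  cpre := cpre P n
  hcpre j := by
    unfold cpre
    split_ifs with h
    · simp; omega
    · simp

/-- Block lengths are below the register width. [folklore] -/
theorem Lof_lt_Ltop (u : Fin (nU P n)) : Lof P n u < Ltop P n := by
  unfold Lof Ltop
  have := (eU P n u).1.isLt
  omega

/-- The prefixes present the headers: `cpre j ++ x' = hdr n j x'` for `j < Ltop`. [cite: AroraBarakCC2009, §1.3] -/
theorem cpre_append {j : ℕ} (hj : j < Ltop P n) (x' : List Bool) : cpre P n j ++ x' = hdr n j x' := by
  simp [cpre, hj, hdr]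

/-- The type of control `j`: sine test iff its test is of type `true`. [folklore] -/
def famσ (j : Fin (k₁ (spec P n))) : Bool := ((eK P n) (finProdFinEquiv.symm j).2).2.1

/-- **The quantum core of the distinguisher**: on inputs of length `n`, the sandwich circuit around
the block of `spec P n`. [cite: AaronsonChen2017, App. 13 (proof of Lemma 7.5)] -/
def family : QCircuitFamily cliffordT where
  ancillas n := (k₁ (spec P n) + k₂ (spec P n)) + mW (spec P n)
  circ n := sandwich (blockCirc (spec P n) n) (famσ P n)

/-! ### The layout of the controls -/

/-- The layout of the control wires: control `j` carries the test `(e j).2` of unit `(e j).1`. [folklore] -/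
def eCtl : Fin (k₁ (spec P n)) ≃ Fin (nU P n) × TIdx (Lv P n) (Bn P n) :=
  finProdFinEquiv.symm.trans (Equiv.prodCongr (Equiv.refl _) (eK P n))

/-- The unit of control `j`. [folklore] -/
def un (j : Fin (k₁ (spec P n))) : Fin (nU P n) := (eCtl P n j).1

/-- The level of control `j`. [folklore] -/
def lev (j : Fin (k₁ (spec P n))) : ℕ := ((eCtl P n j).2.1 : ℕ)

/-- **Kitaev's exponent of unit `u` is the sum over its steps.** [cite: Kitaev1995, §3 Lemma 10] -/
theorem trialExp_eq_sum (u : Fin (nU P n)) (yf : QReg (k₁ (spec P n))) :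
    trialExp (un P n) (lev P n) u yf =
      ∑ s : Fin (spec P n).K, (yOfFlat (spec P n) yf u s).toNat * 2 ^ (spec P n).lvl s := by
  unfold trialExp
  rw [sum_filter, ← finProdFinEquiv.sum_comp, Fintype.sum_prod_type]
  have hzero : ∀ u' ≠ u, (∑ s : Fin (Kn P n), if un P n (finProdFinEquiv (u', s)) = u then
      (yf (finProdFinEquiv (u', s))).toNat * 2 ^ lev P n (finProdFinEquiv (u', s)) else 0) = 0 :=
    fun u' hu' => sum_eq_zero fun s _ => if_neg (by simpa [un, eCtl] using hu')
  rw [Fintype.sum_eq_single u hzero]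
  refine sum_congr rfl fun s _ => ?_
  rw [if_pos (by simp [un, eCtl])]
  simp [lev, eCtl, yOfFlat]

/-! ### The offset register as `∏_u [0, 2^{L_u})` times junk -/

/-- Bit tuples as numbers (little-endian). [folklore] -/
def bitsEquiv (L : ℕ) : (Fin L → Bool) ≃ Fin (2 ^ L) :=
  (Equiv.arrowCongr (Equiv.refl _) finTwoEquiv.symm).trans finFunctionFinEquiv

/-- The number of a bit tuple is its little-endian value. [folklore] -/
theorem val_bitsEquiv {L : ℕ} (f : Fin L → Bool) : (bitsEquiv L f : ℕ) = Nat.ofBits f := by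
  rw [bitsEquiv, Equiv.trans_apply, finFunctionFinEquiv_apply, ofBits_eq_sum]
  refine sum_congr rfl fun i _ => ?_
  congr 1
  show ((finTwoEquiv.symm (f i) : Fin 2) : ℕ) = (f i).toNat
  cases f i <;> rfl

/-- Splitting a register of `Ltop` bits into its low `L` bits and the rest. [folklore] -/
def splitBits {L Ltop : ℕ} (h : L ≤ Ltop) : (Fin Ltop → Bool) ≃ (Fin L → Bool) × (Fin (Ltop - L) → Bool) :=
  (Equiv.arrowCongr (finSumFinEquiv.trans (finCongr (Nat.add_sub_cancel' h))).symm (Equiv.refl _)).trans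
    (Equiv.sumArrowEquivProdArrow _ _ _)

/-- The low part reads the low positions. [folklore] -/
theorem splitBits_fst {L Ltop : ℕ} (h : L ≤ Ltop) (f : Fin Ltop → Bool) (i : Fin L) :
    (splitBits h f).1 i = f (Fin.castLE h i) := by
  simp [splitBits, Equiv.sumArrowEquivProdArrow, Equiv.arrowCongr]
  congr 1

/-- The junk register: the high bits of every offset block. [folklore] -/
abbrev Junk : Type := (u : Fin (nU P n)) → (Fin (Ltop P n - Lof P n u) → Bool)

/-- **The offset register identified with `(∏_u [0, 2^{L_u})) × Junk`.** [folklore] -/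
def zvEquiv : QReg (k₂ (spec P n)) ≃ ((u : Fin (nU P n)) → Fin (Qof (spec P n).L u)) × Junk P n :=
  ((Equiv.arrowCongr finProdFinEquiv.symm (Equiv.refl Bool)).trans
    ((Equiv.curry _ _ _).trans (Equiv.piCongrRight fun u =>
      (splitBits ((spec P n).hL u)).trans (Equiv.prodCongr (bitsEquiv _) (Equiv.refl _))))).trans
    (Equiv.arrowProdEquivProdArrow _ _ _)

/-- **The unit component of the offset register is the value read by the block.** [folklore] -/
theorem val_zvEquiv (Z : QReg (k₂ (spec P n))) (u : Fin (nU P n)) (yf : QReg (k₁ (spec P n))) :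
    (((zvEquiv P n Z).1 u : Fin _) : ℕ) = zval (spec P n) (yOfFlat (spec P n) yf) (zOfFlat (spec P n) Z) u := by
  rw [zval, regVal]
  show ((bitsEquiv _ ((splitBits ((spec P n).hL u)) (fun i => Z (finProdFinEquiv (u, i)))).1 : ℕ)) = _
  rw [val_bitsEquiv]
  congr 1

/-! ### The fibres of the work register in shift form -/

/-- **Hypothesis `hR` of the read-out law**: two control strings give the same work-register
content iff every unit's answer table takes the same value at the shifted offset
`Z_u − A_u(y) (mod 2^{L_u})`. [cite: Kitaev1995, §3 Lemma 10] -/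
theorem blockR_iff_shift (A : Language Bool) (Z : QReg (k₂ (spec P n))) (yf yf' : QReg (k₁ (spec P n))) :
    blockR (spec P n) A yf Z = blockR (spec P n) A yf' Z ↔
      ∀ u, Fu (spec P n) A u (shiftMod (Qof (spec P n).L u)
          ((((zvEquiv P n Z).1 u : Fin _) : ℕ) - (trialExp (un P n) (lev P n) u yf : ℤ))) =
        Fu (spec P n) A u (shiftMod (Qof (spec P n).L u)
          ((((zvEquiv P n Z).1 u : Fin _) : ℕ) - (trialExp (un P n) (lev P n) u yf' : ℤ))) := by
  have key : ∀ y : QReg (k₁ (spec P n)), ∀ u, shiftMod (Qof (spec P n).L u)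
      ((((zvEquiv P n Z).1 u : Fin _) : ℕ) - (trialExp (un P n) (lev P n) u y : ℤ)) =
      xval (spec P n) (yOfFlat (spec P n) y) (zOfFlat (spec P n) Z) u := by
    intro y u
    apply Int.natCast_inj.1
    rw [shiftMod, Int.toNat_of_nonneg (Int.emod_nonneg _ (by
        have := Qof_pos (spec P n).L u; exact_mod_cast this.ne')),
      xval_eq_emod, val_zvEquiv P n Z u y, trialExp_eq_sum]
    push_cast
    rfl
  simp_rw [key]
  exact blockR_eq_iff A yf yf' Z

/-! ### The law of the family -/

/-- **The read-out law of the quantum core, relative to any oracle**: on an input `x` of length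
`n`, the Born probability that the structured control read-out lies in `E` is `prob unitLaw E` —
the units are independent, each following the per-unit law of its answer table `Fu`.
[cite: Kitaev1995, §3 (Lemma 8, Lemma 10) and §4; Shor1997, §5] -/
theorem family_law (A : Language Bool) (x : QReg n)
    (E : Finset (Fin (nU P n) → TIdx (Lv P n) (Bn P n) → Bool)) :
    ∑ z ∈ univ.filter (fun z : QReg (NN (spec P n) n) =>
        structRead (eCtl P n) (fun j => z (yWire n (k₁ (spec P n)) (k₂ (spec P n)) (mW (spec P n)) j)) ∈ E),
        ‖((family P).circ n).runOn A (basisState (padInput x _)) z‖ ^ 2 =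
      prob (X := fun _ : Fin (nU P n) => TIdx (Lv P n) (Bn P n) → Bool)
        (unitLaw (spec P n).L (Fu (spec P n) A)) E :=
  sandwich_law_struct (spec P n).L (Fu (spec P n) A) (eCtl P n) (un := un P n) (lev := lev P n)
    (σ := famσ P n) (fun _ => rfl) (fun _ => rfl) (fun _ => rfl) (zvEquiv P n) A
    (blockCirc (spec P n) n) x (blockR (spec P n) A)
    (fun yf Z => blockCirc_mulVec_coinInput A x yf Z)
    (fun Z y y' => blockR_iff_shift P n A Z y y') E

/-! ### The law on output strings -/

/-- The structured read-outs of the quantum core on inputs of length `n`. [folklore] -/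
abbrev Readout : Type := Fin (nU P n) → TIdx (Lv P n) (Bn P n) → Bool

/-- The control bits of an output string of the quantum core on inputs of length `n` (the control
wires are `n, …, n + k₁ − 1`). [folklore] -/
def ctlOf (y : List Bool) : Fin (k₁ (spec P n)) → Bool := fun j => y.getD (n + j) false

/-- The structured read-out of an output string. [folklore] -/
def readOf (y : List Bool) : Readout P n := structRead (eCtl P n) (ctlOf P n y)

variable {P n}

/-- On the read-out of all wires, `ctlOf` reads the control wires. [folklore] -/
theorem ctlOf_ofFn (z : QReg (NN (spec P n) n)) :
    ctlOf P n (List.ofFn z) = fun j => z (yWire n (k₁ (spec P n)) (k₂ (spec P n)) (mW (spec P n)) j) := by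
  funext j
  have hlt : n + j < NN (spec P n) n := by
    have := j.isLt
    simp only [NN]
    omega
  have hw : (⟨n + j, hlt⟩ : Fin (NN (spec P n) n)) = yWire n (k₁ (spec P n)) (k₂ (spec P n)) (mW (spec P n)) j :=
    Fin.ext (by rw [val_yWire])
  rw [ctlOf, List.getD_eq_getElem?_getD, List.getElem?_ofFn, dif_pos hlt, Option.getD_some, hw]

variable (P n)

/-- **The read-out law on output strings**: the Born mass of the outputs whose string read-out
lies in `E` is `prob unitLaw E` (the form matching `toReal_outputPMF_map_ofFn`). [cite: Kitaev1995, §3–§4] -/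
theorem family_law_str (A : Language Bool) (x : QReg n) (E : Finset (Readout P n))
    [DecidablePred (· ∈ {y : List Bool | readOf P n y ∈ E})] :
    ∑ z : QReg (NN (spec P n) n), (if List.ofFn z ∈ {y : List Bool | readOf P n y ∈ E} then
        ‖((family P).circ n).runOn A (basisState (padInput x _)) z‖ ^ 2 else 0) =
      prob (X := fun _ : Fin (nU P n) => TIdx (Lv P n) (Bn P n) → Bool)
        (unitLaw (spec P n).L (Fu (spec P n) A)) E := by
  rw [← family_law P n A x E, sum_filter]
  refine sum_congr rfl fun z _ => ?_
  -- (`rw`, not `Iff.rfl`: the kernel must not unfold `List.ofFn z` at this length)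
  have hr : List.ofFn z ∈ {y : List Bool | readOf P n y ∈ E} ↔ structRead (eCtl P n)
      (fun j => z (yWire n (k₁ (spec P n)) (k₂ (spec P n)) (mW (spec P n)) j)) ∈ E := by
    rw [Set.mem_setOf_eq]
    unfold readOf
    rw [ctlOf_ofFn]
  by_cases h : structRead (eCtl P n) (fun j => z (yWire n (k₁ (spec P n)) (k₂ (spec P n)) (mW (spec P n)) j)) ∈ E
  · rw [if_pos (hr.2 h), if_pos h]
  · rw [if_neg (fun h' => h (hr.1 h')), if_neg h]

end PeriodFinding

end Literature.Computability.Cryptography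

end
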